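import Mathlib
import Summits.Ventures.HodgeRepro2.PeterssonSupBound
import Summits.Ventures.HodgeRepro2.CauchyEstimateLipschitz
import Summits.Ventures.HodgeRepro2.HolomorphicPeterssonSpace

/-!
# HolomorphicFiniteDimensional — the holomorphic weight-`k` forms on the compact Picard modular
surface form a FINITE-DIMENSIONAL subspace of the Petersson space

Blind cell `pub-hodge-repro2`, seat p2 (Tier 5 kernel support: this discharges the hypothesis
`[FiniteDimensional ℂ (holomorphicSpace hQ S hS k hD)]` of the Hecke-eigenform theorems of
`HolomorphicPeterssonSpace.lean`, `HeckeFiniteIndex.lean`, `MultiplicityOnePeriod.lean` and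
`NonVanishingHeckeEigenform.lean` — «`S_k(Γ)` is finite-dimensional» in kernel).

Proof (Riesz / Arzelà–Ascoli). Let `C₀ ⊂ 𝔹²` be compact with `S·C₀ = 𝔹²`
(`BallQuotientCompactTransfer.exists_isCompact_image_mk_eq_univ`) and `C` its image in `Fin 2 → ℂ`.
* Norm equivalence: for a continuous weight-`k` form `f`, the Petersson density is `S`-invariant
  and at most `‖f‖²` on the ball, so `‖mk f‖² = ∫_D petersson k f ≤ μ_B(D) · sup_C ‖f‖²`.
* Equicontinuity: the Petersson sup bound (`PeterssonSupBound.exists_sup_bound_petersson`) on the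
  closed `2ρ`-thickening of `C` and the Cauchy-estimate Lipschitz bound
  (`CauchyEstimateLipschitz.norm_sub_le_of_forall_norm_le`) make the restrictions to `C` of the
  holomorphic forms of Petersson norm `≤ 1` uniformly Lipschitz and uniformly bounded.
* Arzelà–Ascoli (`BoundedContinuousFunction.arzela_ascoli`) ⇒ these restrictions form a totally
  bounded set of `C →ᵇ ℂ`; by the norm equivalence the closed unit ball of the holomorphic part is
  totally bounded in the Petersson norm; Riesz's lemma (`exists_seq_norm_le_one_le_norm_sub`) ⇒
  finite-dimensional (`finiteDimensional_of_totallyBounded_closedBall_one`).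
-/

namespace Summit.Ventures.HodgeRepro2.RieszTotallyBounded

open Metric Set

variable {E : Type*} [NormedAddCommGroup E] [NormedSpace ℂ E]

/-- Scaling: the closed ball of radius `R > 0` is the image of the closed unit ball under
`x ↦ R • x`. -/
theorem closedBall_subset_image_smul {R : ℝ} (hR : 0 < R) :
    closedBall (0:E) R ⊆ (fun x => ((R : ℝ) : ℂ) • x) '' closedBall (0:E) 1 := by
  intro x hx
  refine ⟨((R⁻¹ : ℝ) : ℂ) • x, ?_, ?_⟩
  · rw [mem_closedBall_zero_iff, norm_smul, Complex.norm_real, Real.norm_eq_abs,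
      abs_of_pos (inv_pos.mpr hR)]
    rw [mem_closedBall_zero_iff] at hx
    rw [inv_mul_le_iff₀ hR, mul_one]
    exact hx
  · simp only [smul_smul, ← Complex.ofReal_mul, mul_inv_cancel₀ hR.ne', Complex.ofReal_one,
      one_smul]

/-- **Riesz's lemma, total-boundedness form**: a complex normed space whose closed unit ball is
totally bounded is finite-dimensional. -/
theorem finiteDimensional_of_totallyBounded_closedBall_one
    (h : TotallyBounded (closedBall (0:E) 1)) : FiniteDimensional ℂ E := by
  by_contra hfd
  obtain ⟨R, f, hR, hf, hsep⟩ := exists_seq_norm_le_one_le_norm_sub (𝕜 := ℂ) hfd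
  have hRpos : 0 < R := by linarith
  have hball : TotallyBounded (closedBall (0:E) R) :=
    (h.image (uniformContinuous_const_smul ((R : ℝ) : ℂ))).subset (closedBall_subset_image_smul hRpos)
  obtain ⟨t, htf, hcover⟩ := Metric.totallyBounded_iff.mp hball (1 / 2) (by norm_num)
  have hmem : ∀ n, ∃ y ∈ t, f n ∈ ball y (1 / 2) := fun n => by
    have := hcover (mem_closedBall_zero_iff.mpr (hf n))
    simpa only [mem_iUnion, exists_prop] using this
  choose y hy hfy using hmem
  haveI := htf.to_subtype
  obtain ⟨m, n, hmn, heq⟩ := Finite.exists_ne_map_eq_of_infinite (fun n => (⟨y n, hy n⟩ : t))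
  have hyeq : y m = y n := congrArg Subtype.val heq
  have h1 : dist (f m) (f n) < 1 := by
    have hm := hfy m
    have hn := hfy n
    rw [mem_ball] at hm hn
    calc dist (f m) (f n) ≤ dist (f m) (y m) + dist (y m) (f n) := dist_triangle _ _ _
      _ = dist (f m) (y m) + dist (f n) (y n) := by rw [hyeq, dist_comm (y n)]
      _ < 1 / 2 + 1 / 2 := add_lt_add hm hn
      _ = 1 := by norm_num
  have h2 := hsep hmn
  rw [dist_eq_norm] at h1
  linarith

end Summit.Ventures.HodgeRepro2.RieszTotallyBounded

namespace Summit.Ventures.HodgeRepro2.ShimuraData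

open MeasureTheory Metric Set RieszTotallyBounded
open scoped Real

variable {K : Type*} [Field K] [NumberField K] [NumberField.IsCMField K] {τ₁ : K →+* ℂ}
  {H : Matrix (Fin 3) (Fin 3) K} {Q : Matrix (Fin 3) (Fin 3) ℂ} (hQ : IsFrame K τ₁ H Q)
  (S : Subgroup (GL (Fin 3) K)) (hS : (S : Set (GL (Fin 3) K)) ⊆ unitaryGroup K H)
  [CompactSpace (ballQuotient hQ S hS)] {D : Set ball₂} (k : ℕ)
  (hD : IsBallFundamentalDomain hQ S hS D)

/-- The Petersson norm of a class: `‖mk f‖² = ∫_D petersson k f dμ_B`. -/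
theorem norm_mk_sq (f : PeterssonForms hQ S hS k hD) :
    ‖(SeparationQuotient.mk f : PeterssonSpace hQ S hS k hD)‖ ^ 2
      = ∫ z in D, petersson k (PeterssonForms.toForm hQ S hS k hD f : (Fin 2 → ℂ) → ℂ)
          (z : Fin 2 → ℂ) ∂bergmanBall := by
  rw [SeparationQuotient.norm_mk, norm_sq_eq_re_inner (𝕜 := ℂ), PeterssonForms.inner_def,
    peterssonInner_self, integral_peterssonQuotient_quotientMeasure hQ S hS D _
      ((mem_weightForms τ₁ Q S k).mp (PeterssonForms.toForm hQ S hS k hD f).2).2]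
  exact Complex.ofReal_re _

/-- On the ball the Petersson density is at most `‖f‖²`. -/
theorem petersson_le_norm_sq (f : (Fin 2 → ℂ) → ℂ) {z : Fin 2 → ℂ} (hz : z ∈ ball₂) :
    petersson k f z ≤ ‖f z‖ ^ 2 := by
  simp only [petersson]
  have h1 : 0 ≤ 1 - normSq₂ z := by
    have := normSq₂_lt_one hz
    linarith
  have h2 : 1 - normSq₂ z ≤ 1 := by
    have : 0 ≤ normSq₂ z := by
      simp only [normSq₂]
      positivity
    linarith
  calc ‖f z‖ ^ 2 * (1 - normSq₂ z) ^ k ≤ ‖f z‖ ^ 2 * 1 := by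
        gcongr
        exact pow_le_one₀ h1 h2
    _ = ‖f z‖ ^ 2 := mul_one _

include hD in
/-- **Norm equivalence, one direction**: for a continuous weight-`k` form `f` and a compact
`C₀ ⊂ 𝔹²` meeting every orbit, `∫_D petersson k f dμ_B ≤ μ_B(D) · M²` whenever `‖f‖ ≤ M` on
`C₀`. -/
theorem setIntegral_petersson_le_of_forall_norm_le {C₀ : Set ball₂}
    (hC₀ : ballQuotient.mk hQ S hS '' C₀ = univ) {f : (Fin 2 → ℂ) → ℂ}
    (hf : IsWeightFor τ₁ Q S k f) (hfc : ContinuousOn f ball₂) {M : ℝ}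
    (hM : ∀ u ∈ C₀, ‖f (u : Fin 2 → ℂ)‖ ≤ M) :
    ∫ z in D, petersson k f (z : Fin 2 → ℂ) ∂bergmanBall ≤ bergmanBall.real D * M ^ 2 := by
  letI := frameAction hQ S hS
  have hbound : ∀ z : ball₂, petersson k f (z : Fin 2 → ℂ) ≤ M ^ 2 := by
    intro z
    obtain ⟨u, hu, γ, rfl⟩ := exists_mem_smul_eq_of_image_mk_eq_univ hQ S hS hC₀ z
    rw [petersson_frameAction_smul hQ S hS hf γ u]
    calc petersson k f (u : Fin 2 → ℂ) ≤ ‖f (u : Fin 2 → ℂ)‖ ^ 2 := petersson_le_norm_sq k f u.2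
      _ ≤ M ^ 2 := by
          have h0 : 0 ≤ ‖f (u : Fin 2 → ℂ)‖ := norm_nonneg _
          exact pow_le_pow_left₀ h0 (hM u hu) 2
  have hcont : Continuous (fun z : ball₂ => petersson k f (z : Fin 2 → ℂ)) :=
    continuousOn_univ.mp ((continuousOn_petersson k hfc).comp continuous_subtype_val.continuousOn
      fun z _ => z.2)
  have hDfin : bergmanBall D < ⊤ := bergmanBall_lt_top_of_compactSpace hQ S hS hD
  haveI : IsFiniteMeasure (bergmanBall.restrict D) := isFiniteMeasure_restrict.mpr hDfin.ne
  have hint : IntegrableOn (fun z : ball₂ => petersson k f (z : Fin 2 → ℂ)) D bergmanBall := by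
    refine memLp_one_iff_integrable.mp (MemLp.of_bound hcont.aestronglyMeasurable.restrict (M ^ 2) ?_)
    refine Filter.Eventually.of_forall fun z => ?_
    rw [Real.norm_eq_abs, abs_of_nonneg (petersson_nonneg k f z.2)]
    exact hbound z
  calc ∫ z in D, petersson k f (z : Fin 2 → ℂ) ∂bergmanBall
      ≤ ∫ _ in D, M ^ 2 ∂bergmanBall := by
        refine integral_mono hint (integrable_const _) fun z => hbound z
    _ = bergmanBall.real D * M ^ 2 := by rw [setIntegral_const, smul_eq_mul]

section assembly

variable (hpd : @ProperlyDiscontinuousSMul S ball₂ _ (frameAction hQ S hS).toSMul)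

/-- A representative in `holomorphicForms` of an element of the holomorphic part of the
Petersson space. -/
noncomputable def holRep (v : holomorphicSpace hQ S hS k hD) : PeterssonForms hQ S hS k hD :=
  Classical.choose (Submodule.mem_map.mp v.2)

/-- The representative is holomorphic. -/
theorem holRep_mem (v : holomorphicSpace hQ S hS k hD) :
    holRep hQ S hS k hD v ∈ holomorphicForms hQ S hS k hD :=
  (Classical.choose_spec (Submodule.mem_map.mp v.2)).1

/-- The representative represents. -/
theorem mk_holRep (v : holomorphicSpace hQ S hS k hD) :
    (SeparationQuotient.mk (holRep hQ S hS k hD v) : PeterssonSpace hQ S hS k hD) = v :=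
  (Classical.choose_spec (Submodule.mem_map.mp v.2)).2

/-- The underlying function of the representative. -/
noncomputable abbrev holRepFun (v : holomorphicSpace hQ S hS k hD) : (Fin 2 → ℂ) → ℂ :=
  (PeterssonForms.toForm hQ S hS k hD (holRep hQ S hS k hD v) : (Fin 2 → ℂ) → ℂ)

/-- The representative is a weight-`k` function for `S`. -/
theorem holRepFun_isWeightFor (v : holomorphicSpace hQ S hS k hD) :
    IsWeightFor τ₁ Q S k (holRepFun hQ S hS k hD v) :=
  ((mem_weightForms τ₁ Q S k).mp (PeterssonForms.toForm hQ S hS k hD (holRep hQ S hS k hD v)).2).1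

/-- The representative is holomorphic on the ball. -/
theorem holRepFun_differentiableOn (v : holomorphicSpace hQ S hS k hD) :
    DifferentiableOn ℂ (holRepFun hQ S hS k hD v) ball₂ :=
  holRep_mem hQ S hS k hD v

include hpd in
/-- **The holomorphic part of the Petersson space is finite-dimensional.** -/
theorem finiteDimensional_holomorphicSpace : FiniteDimensional ℂ (holomorphicSpace hQ S hS k hD) := by
  -- the compact set `C₀` meeting every orbit, and its image `C` in `ℂ²`
  obtain ⟨C₀, hC₀c, hC₀⟩ := exists_isCompact_image_mk_eq_univ hQ S hS
  set C : Set (Fin 2 → ℂ) := Subtype.val '' C₀ with hCdef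
  have hCc : IsCompact C := hC₀c.image continuous_subtype_val
  have hCb : C ⊆ ball₂ := by
    rintro _ ⟨u, -, rfl⟩
    exact u.2
  -- the `2ρ`-thickening of `C` inside the ball
  obtain ⟨ε, hε, hthick⟩ := hCc.exists_cthickening_subset_open isOpen_ball₂ hCb
  set ρ := ε / 2 with hρdef
  have hρ : 0 < ρ := by positivity
  have hthick' : cthickening (2 * ρ) C ⊆ ball₂ := by
    rw [hρdef, show 2 * (ε / 2) = ε by ring]
    exact hthick
  have hC₂c : IsCompact (cthickening (2 * ρ) C) := hCc.cthickening
  -- the Petersson sup bound on the thickening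
  obtain ⟨c₂, hc₂, hsup⟩ := exists_sup_bound_petersson hQ S hS hpd hC₂c hthick' hD k
  -- constants
  set M := Real.sqrt c₂ with hMdef
  have hM : 0 ≤ M := Real.sqrt_nonneg _
  set L := 2 * M / ρ with hLdef
  have hL : 0 ≤ L := by positivity
  set K₁ := Real.sqrt (bergmanBall.real D) with hK₁def
  have hK₁ : 0 ≤ K₁ := Real.sqrt_nonneg _
  -- the restriction map to `C` (bounded continuous functions on the compact subtype `C`)
  haveI : CompactSpace C := isCompact_iff_compactSpace.mp hCc
  let R : holomorphicSpace hQ S hS k hD → BoundedContinuousFunction C ℂ := fun v =>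
    BoundedContinuousFunction.mkOfCompact
      ⟨fun x : C => holRepFun hQ S hS k hD v x,
        (holRepFun_differentiableOn hQ S hS k hD v).continuousOn.comp_continuous
          continuous_subtype_val fun x => hCb x.2⟩
  have hR_apply : ∀ v (x : C), R v x = holRepFun hQ S hS k hD v x := fun v x => rfl
  -- (1) norm equivalence: `‖v - v'‖ ≤ K₁ * ‖R v - R v'‖`
  have hnorm : ∀ v v' : holomorphicSpace hQ S hS k hD, ‖v - v'‖ ≤ K₁ * ‖R v - R v'‖ := by
    intro v v'
    have hrep : ((v - v' : holomorphicSpace hQ S hS k hD) : PeterssonSpace hQ S hS k hD)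
        = SeparationQuotient.mk (holRep hQ S hS k hD v - holRep hQ S hS k hD v') := by
      rw [SeparationQuotient.mk_sub, mk_holRep, mk_holRep]
      rfl
    have hsq : ‖v - v'‖ ^ 2 ≤ (K₁ * ‖R v - R v'‖) ^ 2 := by
      rw [← Submodule.norm_coe, hrep, norm_mk_sq]
      have hfw : IsWeightFor τ₁ Q S k
          (holRepFun hQ S hS k hD v - holRepFun hQ S hS k hD v') :=
        ((mem_weightForms τ₁ Q S k).mp
          (PeterssonForms.toForm hQ S hS k hD
            (holRep hQ S hS k hD v - holRep hQ S hS k hD v')).2).1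
      have hfc : ContinuousOn (holRepFun hQ S hS k hD v - holRepFun hQ S hS k hD v') ball₂ :=
        ((mem_weightForms τ₁ Q S k).mp
          (PeterssonForms.toForm hQ S hS k hD
            (holRep hQ S hS k hD v - holRep hQ S hS k hD v')).2).2
      have hMb : ∀ u ∈ C₀, ‖(holRepFun hQ S hS k hD v - holRepFun hQ S hS k hD v')
          (u : Fin 2 → ℂ)‖ ≤ ‖R v - R v'‖ := by
        intro u hu
        have := BoundedContinuousFunction.norm_coe_le_norm (R v - R v') ⟨u, ⟨u, hu, rfl⟩⟩
        rw [BoundedContinuousFunction.coe_sub, Pi.sub_apply, hR_apply, hR_apply] at this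
        exact this
      have := setIntegral_petersson_le_of_forall_norm_le hQ S hS k hD hC₀ hfw hfc hMb
      calc ∫ z in D, petersson k (PeterssonForms.toForm hQ S hS k hD
            (holRep hQ S hS k hD v - holRep hQ S hS k hD v') : (Fin 2 → ℂ) → ℂ)
            (z : Fin 2 → ℂ) ∂bergmanBall
          = ∫ z in D, petersson k (holRepFun hQ S hS k hD v - holRepFun hQ S hS k hD v')
            (z : Fin 2 → ℂ) ∂bergmanBall := rfl
        _ ≤ bergmanBall.real D * ‖R v - R v'‖ ^ 2 := this
        _ = (K₁ * ‖R v - R v'‖) ^ 2 := by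
            rw [mul_pow, hK₁def, Real.sq_sqrt measureReal_nonneg]
    exact (pow_le_pow_iff_left₀ (norm_nonneg _) (by positivity) two_ne_zero).mp hsq
  -- (2) the sup bound on the `2ρ`-thickening for the unit ball, and the Lipschitz bound on `C`
  have hsupv : ∀ v : holomorphicSpace hQ S hS k hD, ‖v‖ ≤ 1 →
      ∀ z ∈ cthickening (2 * ρ) C, ‖holRepFun hQ S hS k hD v z‖ ≤ M := by
    intro v hv z hz
    have h := hsup (holRepFun_isWeightFor hQ S hS k hD v)
      (holRepFun_differentiableOn hQ S hS k hD v) z hz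
    have hv2 : ∫ w in D, petersson k (holRepFun hQ S hS k hD v) (w : Fin 2 → ℂ) ∂bergmanBall ≤ 1 := by
      have h1 := norm_mk_sq hQ S hS k hD (holRep hQ S hS k hD v)
      rw [mk_holRep, Submodule.norm_coe] at h1
      rw [← h1]
      exact pow_le_one₀ (norm_nonneg _) hv
    have hsq : ‖holRepFun hQ S hS k hD v z‖ ^ 2 ≤ M ^ 2 := by
      calc ‖holRepFun hQ S hS k hD v z‖ ^ 2
          ≤ c₂ * ∫ w in D, petersson k (holRepFun hQ S hS k hD v) (w : Fin 2 → ℂ) ∂bergmanBall := h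
        _ ≤ c₂ * 1 := by gcongr
        _ = M ^ 2 := by rw [mul_one, hMdef, Real.sq_sqrt hc₂]
    exact (pow_le_pow_iff_left₀ (norm_nonneg _) hM two_ne_zero).mp hsq
  have hlip : ∀ v : holomorphicSpace hQ S hS k hD, ‖v‖ ≤ 1 → ∀ z ∈ C, ∀ w ∈ C,
      ‖holRepFun hQ S hS k hD v z - holRepFun hQ S hS k hD v w‖ ≤ L * ‖z - w‖ :=
    fun v hv z hz w hw => CauchyEstimate.norm_sub_le_of_forall_norm_le hρ hM isOpen_ball₂ hthick'
      (holRepFun_differentiableOn hQ S hS k hD v) (hsupv v hv) hz hw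
  -- (3) Arzelà–Ascoli for the restrictions of the unit ball
  set A : Set (BoundedContinuousFunction C ℂ) := R '' {v | ‖v‖ ≤ 1} with hAdef
  have hA : IsCompact (closure A) := by
    refine BoundedContinuousFunction.arzela_ascoli (closedBall (0:ℂ) M) (isCompact_closedBall _ _)
      A ?_ ?_
    · rintro g x ⟨v, hv, rfl⟩
      rw [mem_closedBall_zero_iff, hR_apply]
      exact hsupv v hv x (self_subset_cthickening C x.2)
    · intro x₀
      rw [Metric.equicontinuousAt_iff]
      intro ε hε
      refine ⟨ε / (L + 1), by positivity, ?_⟩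
      intro x hx i
      obtain ⟨v, hv, hiv⟩ := i.2
      have hi : (i : BoundedContinuousFunction C ℂ) = R v := hiv.symm
      rw [dist_eq_norm, hi, hR_apply, hR_apply]
      have hdist : ‖(x₀ : Fin 2 → ℂ) - x‖ ≤ ε / (L + 1) := by
        rw [← dist_eq_norm, ← Subtype.dist_eq, dist_comm]
        exact hx.le
      calc ‖holRepFun hQ S hS k hD v x₀ - holRepFun hQ S hS k hD v x‖
          ≤ L * ‖(x₀ : Fin 2 → ℂ) - x‖ := hlip v hv x₀ x₀.2 x x.2
        _ ≤ L * (ε / (L + 1)) := by gcongr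
        _ < ε := by
            rw [mul_div_assoc', div_lt_iff₀ (by positivity)]
            nlinarith
  have hAtb : TotallyBounded A := hA.totallyBounded.subset subset_closure
  -- (4) the closed unit ball of the holomorphic part is totally bounded
  have htb : TotallyBounded (closedBall (0 : holomorphicSpace hQ S hS k hD) 1) := by
    rw [Metric.totallyBounded_iff]
    intro ε hε
    obtain ⟨t, htA, htf, hcover⟩ :=
      Metric.finite_approx_of_totallyBounded hAtb (ε / (K₁ + 1)) (by positivity)
    have hpre : ∀ y ∈ t, ∃ v : holomorphicSpace hQ S hS k hD, ‖v‖ ≤ 1 ∧ R v = y := fun y hy => by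
      obtain ⟨v, hv, hvy⟩ := htA hy
      exact ⟨v, hv, hvy⟩
    choose! vOf hvOf using hpre
    refine ⟨vOf '' t, htf.image _, ?_⟩
    intro v hv
    rw [mem_closedBall_zero_iff] at hv
    have hRv : R v ∈ A := ⟨v, hv, rfl⟩
    have hcov := hcover hRv
    simp only [mem_iUnion, exists_prop] at hcov
    obtain ⟨y, hy, hRy⟩ := hcov
    rw [mem_iUnion₂]
    refine ⟨vOf y, ⟨y, hy, rfl⟩, ?_⟩
    rw [mem_ball, dist_eq_norm]
    have h1 := hnorm v (vOf y)
    rw [(hvOf y hy).2] at h1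
    rw [mem_ball, dist_eq_norm] at hRy
    calc ‖v - vOf y‖ ≤ K₁ * ‖R v - y‖ := h1
      _ ≤ K₁ * (ε / (K₁ + 1)) := by gcongr
      _ < ε := by
          rw [mul_div_assoc', div_lt_iff₀ (by positivity)]
          nlinarith
  exact finiteDimensional_of_totallyBounded_closedBall_one htb

end assembly

end Summit.Ventures.HodgeRepro2.ShimuraData
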